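import Mathlib.Analysis.Complex.RemovableSingularity
import Mathlib.Analysis.Complex.Liouville
import HarnessLib

/-!
# Route `SullivanDual`, crux `HyperbolicEnd` (stmt-SmoothPoincare4-7825), line `taubes-circle-pencil`:
# Liouville off a finite set

Registered helper `helper_const_of_bounded_holomorphic_off_finset` of the crux item: a function
`ℂ → ℂ` that is complex differentiable and bounded on the complement of a finite set is constant
there (removable singularities at the finitely many points, then Liouville).  This is the analytic
core of the PARABOLICITY LEMMA (R2) of the lead memo `Cruxes/HyperbolicEnd/Lines/
taubes-circle-pencil-walls.md`: the leaves of a transparent foliation (`IsTransparentFoliation.leaves`: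
finite unions of injective `J`-holomorphic images of `ℂ ∖ A`, `A` finite) carry no non-constant
bounded holomorphic function, hence are `≅ ℂ ∖ A` with point-punctures only.  Mathlib only; no new
definitions.
-/

-- the registered namespace `Summit.SmoothPoincare4.SmoothPoincare4.…` repeats a component (P = Sub)
set_option linter.dupNamespace false

open Set Filter Topology Complex

namespace Summit.SmoothPoincare4.SmoothPoincare4.Cruxes.HyperbolicEnd.TaubesCirclePencil

/-- One removable singularity: if `f` is complex differentiable off `insert a s` (`s` finite,
`a ∉ s`) and bounded by `M` there, then `f` redefined at `a` by its limit is complex differentiable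
off `s` and still bounded by `M` there. [folklore] -/
theorem differentiableOn_update_of_bounded (s : Finset ℂ) (a : ℂ) (ha : a ∉ s) (f : ℂ → ℂ) (M : ℝ)
    (hd : DifferentiableOn ℂ f (↑(insert a s : Finset ℂ) : Set ℂ)ᶜ)
    (hb : ∀ z : ℂ, z ∉ insert a s → ‖f z‖ ≤ M) :
    DifferentiableOn ℂ (Function.update f a (limUnder (𝓝[≠] a) f)) (↑s : Set ℂ)ᶜ ∧
      ∀ z : ℂ, z ∉ s → ‖Function.update f a (limUnder (𝓝[≠] a) f) z‖ ≤ M := by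
  set g := Function.update f a (limUnder (𝓝[≠] a) f) with hg
  -- a ball about `a` missing `s`
  have hopen : IsOpen ((↑s : Set ℂ)ᶜ) := s.finite_toSet.isClosed.isOpen_compl
  have ha' : a ∈ (↑s : Set ℂ)ᶜ := by simpa using ha
  obtain ⟨r, hr, hball⟩ := Metric.isOpen_iff.mp hopen a ha'
  -- on the punctured ball `f` is differentiable and bounded
  have hsub : Metric.ball a r \ {a} ⊆ (↑(insert a s : Finset ℂ) : Set ℂ)ᶜ := by
    intro z hz
    rcases hz with ⟨hz1, hz2⟩
    have hzs : z ∉ (↑s : Set ℂ) := hball hz1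
    simp only [Finset.coe_insert, mem_compl_iff, mem_insert_iff, not_or]
    exact ⟨hz2, hzs⟩
  have hda : DifferentiableOn ℂ g (Metric.ball a r) := by
    refine differentiableOn_update_limUnder_of_bddAbove (Metric.ball_mem_nhds a hr) (hd.mono hsub) ?_
    refine ⟨M, ?_⟩
    rintro _ ⟨z, hz, rfl⟩
    have := hsub hz
    simp only [Finset.coe_insert, mem_compl_iff, mem_insert_iff, not_or] at this
    exact hb z (by simpa [Finset.mem_insert] using this)
  have hga : DifferentiableAt ℂ g a := hda.differentiableAt (Metric.ball_mem_nhds a hr)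
  -- differentiability of `g` off `s`
  have hdiff : DifferentiableOn ℂ g (↑s : Set ℂ)ᶜ := by
    intro z hz
    by_cases hza : z = a
    · subst hza
      exact hga.differentiableWithinAt
    · -- near `z`, `g = f` and `f` is differentiable
      have hzI : z ∈ (↑(insert a s : Finset ℂ) : Set ℂ)ᶜ := by
        simp only [Finset.coe_insert, mem_compl_iff, mem_insert_iff, not_or]
        exact ⟨hza, hz⟩
      have hopenI : IsOpen ((↑(insert a s : Finset ℂ) : Set ℂ)ᶜ) :=
        (insert a s).finite_toSet.isClosed.isOpen_compl
      have hfz : DifferentiableAt ℂ f z := hd.differentiableAt (hopenI.mem_nhds hzI)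
      have heq : g =ᶠ[𝓝 z] f := by
        filter_upwards [isOpen_ne.mem_nhds hza] with w hw
        rw [hg, Function.update_of_ne hw]
      exact (hfz.congr_of_eventuallyEq heq).differentiableWithinAt
  refine ⟨hdiff, ?_⟩
  intro z hz
  by_cases hza : z = a
  · subst hza
    -- `g z` is the limit of `f` along `𝓝[≠] z`, and `‖f‖ ≤ M` there
    have hcont : ContinuousAt g z := hga.continuousAt
    have htend : Tendsto g (𝓝[≠] z) (𝓝 (g z)) := hcont.tendsto.mono_left nhdsWithin_le_nhds
    have hev : ∀ᶠ w in 𝓝[≠] z, ‖g w‖ ≤ M := by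
      have h1 : ∀ᶠ w in 𝓝[≠] z, w ∈ Metric.ball z r \ {z} := by
        exact sdiff_mem_nhdsWithin_compl (Metric.ball_mem_nhds z hr) {z}
      filter_upwards [h1] with w hw
      rw [hg, Function.update_of_ne hw.2]
      have := hsub hw
      simp only [Finset.coe_insert, mem_compl_iff, mem_insert_iff, not_or] at this
      exact hb w (by simpa [Finset.mem_insert] using this)
    exact le_of_tendsto ((continuous_norm.tendsto _).comp htend) hev
  · rw [hg, Function.update_of_ne hza]
    exact hb z (by simpa [Finset.mem_insert] using not_or.mpr ⟨hza, hz⟩)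

/-- **Liouville off a finite set.**  A function `f : ℂ → ℂ` that is complex differentiable and
bounded on the complement of a finite set `A` takes the same value at any two points off `A`
(removable singularities + Liouville).  Registered helper of stmt-SmoothPoincare4-7825: the analytic
core of the parabolicity of transparent leaves. [folklore] -/
theorem helper_const_of_bounded_holomorphic_off_finset :
    ∀ (A : Finset ℂ) (f : ℂ → ℂ) (M : ℝ), DifferentiableOn ℂ f (↑A : Set ℂ)ᶜ →
      (∀ z : ℂ, z ∉ A → ‖f z‖ ≤ M) → ∀ z w : ℂ, z ∉ A → w ∉ A → f z = f w := by
  intro A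
  induction A using Finset.induction_on with
  | empty =>
    intro f M hd hb z w _ _
    have hdiff : Differentiable ℂ f := by
      simpa [differentiableOn_univ] using hd
    have hbdd : Bornology.IsBounded (range f) := by
      refine (Metric.isBounded_closedBall (x := (0 : ℂ)) (r := M)).subset ?_
      rintro _ ⟨z, rfl⟩
      simpa using hb z (by simp)
    exact hdiff.apply_eq_apply_of_bounded hbdd z w
  | insert a s ha ih =>
    intro f M hd hb z w hz hw
    obtain ⟨hdiff, hbdd⟩ := differentiableOn_update_of_bounded s a ha f M hd hb
    have hz' : z ∉ s := fun h => hz (Finset.mem_insert_of_mem h)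
    have hw' : w ∉ s := fun h => hw (Finset.mem_insert_of_mem h)
    have hza : z ≠ a := fun h => hz (h ▸ Finset.mem_insert_self a s)
    have hwa : w ≠ a := fun h => hw (h ▸ Finset.mem_insert_self a s)
    have key := ih (Function.update f a (limUnder (𝓝[≠] a) f)) M hdiff hbdd z w hz' hw'
    rwa [Function.update_of_ne hza, Function.update_of_ne hwa] at key

end Summit.SmoothPoincare4.SmoothPoincare4.Cruxes.HyperbolicEnd.TaubesCirclePencil
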